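import Literature.Probability.LatticeModels.SlitPlaneSpinor
import HarnessLib

/-!
# The slit-plane kernel, IV: the discrete primitive `G_{[ℂ_δ,a]}` in closed form

Topic `Literature/Probability/LatticeModels`; sequel of `SlitPlaneKernel.lean`,
`SlitPlaneKernelBounds.lean`, `SlitPlaneSpinor.lean`. Chelkak–Hongler–Izyurov (Ann. of Math. 181
(2015) = arXiv:1202.2838), Lemma 2.16 and §3.2.3, construct the discrete counterpart
`G_{[ℂ_δ,a]}` of `Re √(z - a)` by "discrete integration" of the tip harmonic measure
`F¹ = hm_{tip}` along the direction of the cut: `G(z) := δ ∑_{j ≥ 0} F¹(z - 2jδ)` (def_r), and prove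
that it vanishes on the cut `L_a`, equals `δ` at `a + 3δ/2`, and is discrete harmonic **everywhere
in `Ξ_+`, the point `a + 3δ/2` included** (the discrete Green formula argument (3.9)). With the
closed form `K(k,s) = (1/π)∫ Re(e^{-ikt} ĝ y^s)`, `ĝ = (1 - e^{2it})^{-1/2}`, of `SlitPlaneKernel.lean`
the series is summed in closed form: formally `∑_j e^{2ijt} = (1 - e^{2it})^{-1}` turns `ĝ` into
`(1 - e^{2it})^{-3/2}`, which is not integrable at `t = 0`, but the **regularised** integrand
`(e^{-ikt} y^s - 1)(1 - e^{2it})^{-3/2} = O(|t|^{-1/2})` is, and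

  `G(k, s) := 1 + (1/π) ∫_{-π/2}^{π/2} Re[ (e^{-ikt} y(t)^s - 1)(1 - e^{2it})^{-3/2} ] dt`

has all the properties of CHI's `G` (in units where `δ = 1`, `F¹(tip) = 1`), proved here directly
and without any summability:

* `slitG_sub : G(k, s) - G(k-2, s) = K(k, s)` (the defining relation (def_r):
  `(e^{-ikt} - e^{-i(k-2)t})(1 - e^{2it})^{-3/2} = e^{-ikt}(1 - e^{2it})^{-1/2}`);
* `slitG_zero_zero : G(tip) = 1`, `slitG_slit : G(-2m, 0) = 0` (`m ≥ 1`),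
  `slitG_two_mul : G(2m, 0) = ∑_{j ≤ m} binom(2j,j)/4^j`;
* `slitG_harmonic` (`s ≥ 1`) and **`slitG_row : G(k,0) - ½[G(k-1,1) + G(k+1,1)] = -½ K(-k-2, 0)`**
  (pointwise: `(1 - e^{2it})^{-3/2}|sin t| = -½ e^{-2it} conj ĝ`), whence
  `slitG_row_of_nonneg` — harmonicity at `(2m, 0)` for every `m ≥ 0`, the tip `m = 0` included;
* on `ℤ²`: `slitGM (a,b) = G(a+b, |a-b|)`, `latticeLaplacian_slitGM_of_ne`,
  `latticeLaplacian_slitGM_diag_of_nonneg`, **`latticeLaplacian_slitGM_zero`** (harmonic at the tip),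
  `slitGM_zero = 1`, `slitGM_diag_neg` (zero on the slit), `slitGM_diag`, and the flux into the slit
  `latticeLaplacian_slitGM_diag_of_neg`.

Everything is proved; no named fact. NOT here: the growth `G = O(|z|^{1/2})` and the convergence
`G/ν(δ) → Re √(z - a)` of Lemma 2.16 (asymptotics of the two closed forms), and the symmetric
extension to the double cover.

## References

* D. Chelkak, C. Hongler, K. Izyurov, Ann. of Math. 181 (2015) = arXiv:1202.2838: Lemma 2.16,
  §3.2.3 ((def_r), (3.9)) [ChelkakHonglerIzyurovAnnals2015].
-/

noncomputable section

open Complex MeasureTheory intervalIntegral Set Filter Topology Metric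
open scoped Real ComplexConjugate Interval

namespace Literature.Probability.LatticeModels

/-! ### The regularised integrand `(e^{-ikt} y^s - 1)(1 - e^{2it})^{-3/2}` -/

/-- The exponent `-3/2` is a real number. [folklore] -/
theorem neg_three_halves_eq_ofReal : (-(3 / 2 : ℂ)) = ((-(3 / 2 : ℝ) : ℝ) : ℂ) := by push_cast; ring

/-- `(1 - e^{2it})^{-3/2}` has norm `(2|sin t|)^{-3/2}`. [folklore] -/
theorem norm_circBase_cpow_neg_three_halves (t : ℝ) :
    ‖circBase 1 (2 * t) ^ (-(3 / 2 : ℂ))‖ = (2 * |Real.sin t|) ^ (-(3 / 2 : ℝ)) := by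
  rw [neg_three_halves_eq_ofReal, norm_cpow_real, norm_circBase_one_two_mul]

/-- `1 - y(t) ≤ 2|t|` for `|t| ≤ π/2`. [folklore] -/
theorem one_sub_chmY_le (t : ℝ) : 1 - chmY t ≤ 2 * |t| := by
  have hpos := one_add_abs_sin_pos t
  have h1 : 1 - chmY t = (1 + |Real.sin t| - Real.cos t) / (1 + |Real.sin t|) := by
    rw [chmY]; field_simp
  rw [h1, div_le_iff₀ hpos]
  have hs : |Real.sin t| ≤ |t| := Real.abs_sin_le_abs
  have hc : 1 - Real.cos t ≤ |t| := by
    have h2 := Real.one_sub_sq_div_two_le_cos (x := t)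
    rcases le_or_gt |t| 2 with h | h
    · have : t ^ 2 / 2 ≤ |t| := by
        rw [div_le_iff₀ (by norm_num : (0 : ℝ) < 2), ← sq_abs]; nlinarith [abs_nonneg t]
      linarith
    · linarith [Real.cos_le_one t, Real.neg_one_le_cos t]
  nlinarith [abs_nonneg t, abs_nonneg (Real.sin t)]

/-- `|y^s - 1| ≤ s (1 - y)` for `0 ≤ y ≤ 1`. [folklore] -/
theorem one_sub_pow_le_mul {y : ℝ} (h0 : 0 ≤ y) (h1 : y ≤ 1) (s : ℕ) : 1 - y ^ s ≤ s * (1 - y) := by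
  induction s with
  | zero => simp
  | succ n ih =>
    have : 1 - y ^ (n + 1) = (1 - y ^ n) + y ^ n * (1 - y) := by ring
    rw [this]
    have hyn : y ^ n ≤ 1 := pow_le_one₀ h0 h1
    push_cast
    nlinarith

/-- `0 ≤ y(t) ≤ 1` for `|t| ≤ π/2`. [folklore] -/
theorem chmY_nonneg {t : ℝ} (ht : |t| ≤ π / 2) : 0 ≤ chmY t := by
  rw [chmY]
  exact div_nonneg (Real.cos_nonneg_of_mem_Icc ⟨by linarith [abs_le.1 ht], (abs_le.1 ht).2⟩) (one_add_abs_sin_pos t).le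

/-- `y(t) ≤ 1`. [folklore] -/
theorem chmY_le_one (t : ℝ) : chmY t ≤ 1 := (le_abs_self _).trans (abs_chmY_le_one t)

/-- `‖e^{-ikt} y^s - 1‖ ≤ (|k| + 2s)|t|` for `|t| ≤ π/2`. [folklore] -/
theorem norm_cexp_mul_pow_sub_one_le (k : ℤ) (s : ℕ) {t : ℝ} (ht : |t| ≤ π / 2) :
    ‖cexp (-((k : ℂ) * (t : ℂ) * I)) * ((chmY t : ℝ) : ℂ) ^ s - 1‖ ≤ (|(k : ℝ)| + 2 * s) * |t| := by
  have hy0 := chmY_nonneg ht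
  have hy1 := chmY_le_one t
  have h1 : ‖cexp (-((k : ℂ) * (t : ℂ) * I)) - 1‖ ≤ |(k : ℝ)| * |t| := by
    rw [show -((k : ℂ) * (t : ℂ) * I) = I * ((-(k * t) : ℝ) : ℂ) by push_cast; ring]
    refine (Real.norm_exp_I_mul_ofReal_sub_one_le).trans (le_of_eq ?_)
    rw [Real.norm_eq_abs, abs_neg, abs_mul]
  have h2 : ‖((chmY t : ℝ) : ℂ) ^ s - 1‖ ≤ 2 * s * |t| := by
    rw [← ofReal_pow, ← ofReal_one, ← ofReal_sub, Complex.norm_real, Real.norm_eq_abs, abs_sub_comm,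
      abs_of_nonneg (by linarith [pow_le_one₀ hy0 hy1 (n := s)])]
    have := one_sub_pow_le_mul hy0 hy1 s
    have := one_sub_chmY_le t
    nlinarith
  calc ‖cexp (-((k : ℂ) * (t : ℂ) * I)) * ((chmY t : ℝ) : ℂ) ^ s - 1‖
      = ‖cexp (-((k : ℂ) * (t : ℂ) * I)) * (((chmY t : ℝ) : ℂ) ^ s - 1) + (cexp (-((k : ℂ) * (t : ℂ) * I)) - 1)‖ := by
        ring_nf
    _ ≤ ‖cexp (-((k : ℂ) * (t : ℂ) * I)) * (((chmY t : ℝ) : ℂ) ^ s - 1)‖ + ‖cexp (-((k : ℂ) * (t : ℂ) * I)) - 1‖ :=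
        norm_add_le _ _
    _ ≤ 2 * s * |t| + |(k : ℝ)| * |t| := by
        rw [norm_mul, norm_cexp_neg_int_mul, one_mul]; exact add_le_add h2 h1
    _ = (|(k : ℝ)| + 2 * s) * |t| := by ring

/-- **The regularised integrand** of the primitive: `(e^{-ikt} y(t)^s - 1)(1 - e^{2it})^{-3/2}`. [folklore] -/
def slitGFun (k : ℤ) (s : ℕ) (t : ℝ) : ℂ :=
  (cexp (-((k : ℂ) * (t : ℂ) * I)) * ((chmY t : ℝ) : ℂ) ^ s - 1) * circBase 1 (2 * t) ^ (-(3 / 2 : ℂ))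

/-- The regularised integrand is measurable. [folklore] -/
theorem measurable_slitGFun (k : ℤ) (s : ℕ) : Measurable (slitGFun k s) := by
  unfold slitGFun
  refine Measurable.mul ?_ ?_
  · refine Measurable.sub (Measurable.mul (by fun_prop) ?_) measurable_const
    exact (continuous_ofReal.comp continuous_chmY).measurable.pow_const s
  · exact ((continuous_circBase 1).comp (continuous_const.mul continuous_id)).measurable.pow_const _

/-- `|t|^{3/2} ≤ (2|sin t|)^{3/2}`-type bound: `‖(1 - e^{2it})^{-3/2}‖ ≤ |t|^{-3/2}` for `0 < |t| ≤ π/2`. [folklore] -/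
theorem norm_circBase_cpow_neg_three_halves_le {t : ℝ} (ht : |t| ≤ π / 2) (h0 : t ≠ 0) :
    ‖circBase 1 (2 * t) ^ (-(3 / 2 : ℂ))‖ ≤ |t| ^ (-(3 / 2 : ℝ)) := by
  rw [norm_circBase_cpow_neg_three_halves]
  exact Real.rpow_le_rpow_of_nonpos (abs_pos.2 h0) (abs_le_two_mul_abs_sin ht) (by norm_num)

/-- **Integrability bound**: `‖slitGFun k s t‖ ≤ (|k| + 2s) |t|^{-1/2}` for `0 < |t| ≤ π/2`. [folklore] -/
theorem norm_slitGFun_le (k : ℤ) (s : ℕ) {t : ℝ} (ht : |t| ≤ π / 2) (h0 : t ≠ 0) :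
    ‖slitGFun k s t‖ ≤ (|(k : ℝ)| + 2 * s) * |t| ^ (-(1 / 2 : ℝ)) := by
  rw [slitGFun, norm_mul]
  have h1 := norm_cexp_mul_pow_sub_one_le k s ht
  have h2 := norm_circBase_cpow_neg_three_halves_le ht h0
  have hpos : 0 < |t| := abs_pos.2 h0
  calc ‖cexp (-((k : ℂ) * (t : ℂ) * I)) * ((chmY t : ℝ) : ℂ) ^ s - 1‖ * ‖circBase 1 (2 * t) ^ (-(3 / 2 : ℂ))‖
      ≤ (|(k : ℝ)| + 2 * s) * |t| * |t| ^ (-(3 / 2 : ℝ)) :=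
        mul_le_mul h1 h2 (norm_nonneg _) (by positivity)
    _ = (|(k : ℝ)| + 2 * s) * |t| ^ (-(1 / 2 : ℝ)) := by
        rw [mul_assoc]
        congr 1
        rw [show -(1 / 2 : ℝ) = 1 + (-(3 / 2 : ℝ)) by norm_num, Real.rpow_add hpos, Real.rpow_one]

/-- **Integrability of the regularised integrand** on `[-π/2, π/2]`. [folklore] -/
theorem intervalIntegrable_slitGFun (k : ℤ) (s : ℕ) : IntervalIntegrable (slitGFun k s) volume (-(π / 2)) (π / 2) := by
  refine ((intervalIntegrable_abs_rpow (by norm_num : (-1 : ℝ) < -(1 / 2)) _ _).const_mul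
    (|(k : ℝ)| + 2 * s)).mono_fun' (measurable_slitGFun k s).aestronglyMeasurable ?_
  rw [EventuallyLE, ae_restrict_iff' measurableSet_uIoc]
  filter_upwards [ae_ne_zero] with t h0 ht
  exact norm_slitGFun_le k s (abs_le_of_mem_uIoc_half_pi ht) h0

/-- The real part is interval integrable. [folklore] -/
theorem intervalIntegrable_slitGFun_re (k : ℤ) (s : ℕ) :
    IntervalIntegrable (fun t => (slitGFun k s t).re) volume (-(π / 2)) (π / 2) := by
  refine ((intervalIntegrable_abs_rpow (by norm_num : (-1 : ℝ) < -(1 / 2)) _ _).const_mul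
    (|(k : ℝ)| + 2 * s)).mono_fun' (Complex.measurable_re.comp (measurable_slitGFun k s)).aestronglyMeasurable ?_
  rw [EventuallyLE, ae_restrict_iff' measurableSet_uIoc]
  filter_upwards [ae_ne_zero] with t h0 ht
  rw [Real.norm_eq_abs]
  exact (abs_re_le_norm _).trans (norm_slitGFun_le k s (abs_le_of_mem_uIoc_half_pi ht) h0)

/-- **The discrete primitive in closed form**:
`G(k, s) = 1 + (1/π) ∫_{-π/2}^{π/2} Re[(e^{-ikt} y(t)^s - 1)(1 - e^{2it})^{-3/2}] dt`.
[cite: ChelkakHonglerIzyurovAnnals2015, Lemma 2.16 and §3.2.3 (eq. def_r)] -/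
def slitG (k : ℤ) (s : ℕ) : ℝ := 1 + 1 / π * ∫ t in (-(π / 2))..(π / 2), (slitGFun k s t).re


/-! ### `G(k, s) - G(k-2, s) = K(k, s)` and the values on the row -/

/-- `B · B^{-3/2} = B^{-1/2}` for every `B` (both sides vanish at `B = 0`). [folklore] -/
theorem mul_cpow_neg_three_halves (B : ℂ) : B * B ^ (-(3 / 2 : ℂ)) = B ^ (-(1 / 2 : ℂ)) := by
  by_cases hB : B = 0
  · rw [hB, zero_mul, zero_cpow (by norm_num)]
  · have h := cpow_add (1 : ℂ) (-(3 / 2 : ℂ)) hB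
    rw [cpow_one, show (1 : ℂ) + -(3 / 2 : ℂ) = -(1 / 2 : ℂ) by norm_num] at h
    exact h.symm

/-- **The difference identity on integrands**: `slitGFun k s - slitGFun (k-2) s = e^{-ikt} ĝ y^s`. [folklore] -/
theorem slitGFun_sub (k : ℤ) (s : ℕ) (t : ℝ) :
    slitGFun k s t - slitGFun (k - 2) s t = slitCFun k t * ((chmY t : ℝ) : ℂ) ^ s := by
  have he : cexp (-(((k - 2 : ℤ) : ℂ) * (t : ℂ) * I)) = cexp (-((k : ℂ) * (t : ℂ) * I)) * cexp (((2 * t : ℝ) : ℂ) * I) := by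
    rw [← Complex.exp_add]; push_cast; ring_nf
  unfold slitGFun slitCFun slitGHat
  rw [he, ← mul_cpow_neg_three_halves (circBase 1 (2 * t))]
  unfold circBase
  push_cast
  ring

/-- **`G(k, s) - G(k - 2, s) = K(k, s)`** (CHI: `G(z) - G(z - 2δ) = δ F¹(z)`, the definition
(def_r) of `G` as `δ ∑_{j ≥ 0} F¹(z - 2jδ)`). [cite: ChelkakHonglerIzyurovAnnals2015, §3.2.3 (eq. def_r)] -/
theorem slitG_sub (k : ℤ) (s : ℕ) : slitG k s - slitG (k - 2) s = slitKernel k s := by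
  have hI := intervalIntegrable_slitGFun_re
  have hpt : ∀ t, (slitGFun k s t).re - (slitGFun (k - 2) s t).re = slitKerFun k s t := by
    intro t
    rw [← Complex.sub_re, slitGFun_sub, re_mul_pow_ofReal, slitKerFun]
  rw [slitG, slitG, slitKernel, ← intervalIntegral.integral_congr (fun t _ => hpt t),
    intervalIntegral.integral_sub (hI k s) (hI (k - 2) s)]
  ring

/-- **`G(tip) = 1`** (CHI: `G(a + 3δ/2) = δ`): the regularised integrand vanishes identically at
`(k, s) = (0, 0)`. [cite: ChelkakHonglerIzyurovAnnals2015, Lemma 2.16] -/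
theorem slitG_zero_zero : slitG 0 0 = 1 := by
  have : ∀ t, (slitGFun 0 0 t).re = 0 := fun t => by simp [slitGFun]
  rw [slitG, intervalIntegral.integral_congr (g := fun _ => (0 : ℝ)) fun t _ => this t]
  simp

/-- **`G` vanishes on the slit**: `G(-2m, 0) = 0` for `m ≥ 1`. [cite: ChelkakHonglerIzyurovAnnals2015, Lemma 2.16] -/
theorem slitG_slit (m : ℕ) (hm : 1 ≤ m) : slitG (-(2 * (m : ℤ))) 0 = 0 := by
  induction m with
  | zero => omega
  | succ n ih =>
    rcases Nat.eq_zero_or_pos n with hn | hn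
    · subst hn
      have h := slitG_sub 0 0
      rw [slitG_zero_zero, slitKernel_zero_zero] at h
      have : slitG (0 - 2) 0 = 0 := by linarith
      simpa using this
    · have h := slitG_sub (-(2 * (n : ℤ))) 0
      rw [ih hn, show (-(2 * (n : ℤ))) = 2 * (-(n : ℤ)) by ring, slitKernel_two_mul_zero_of_neg (by omega)] at h
      rw [show (-(2 * ((n + 1 : ℕ) : ℤ))) = 2 * (-(n : ℤ)) - 2 by push_cast; ring]
      linarith

/-- **The values on the positive row**: `G(2m, 0) = ∑_{j ≤ m} binom(2j, j)/4^j`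
(`= (2m+1) binom(2m,m)/4^m`). [cite: ChelkakHonglerIzyurovAnnals2015, Lemma 2.16] -/
theorem slitG_two_mul (m : ℕ) : slitG (2 * m) 0 = ∑ j ∈ Finset.range (m + 1), (j.centralBinom : ℝ) / 4 ^ j := by
  induction m with
  | zero => simp [slitG_zero_zero, Nat.centralBinom_zero]
  | succ n ih =>
    have h := slitG_sub (2 * ((n + 1 : ℕ) : ℤ)) 0
    rw [show (2 * ((n + 1 : ℕ) : ℤ) - 2) = 2 * (n : ℤ) by push_cast; ring, ih, slitKernel_two_mul_natCast_zero] at h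
    rw [Finset.sum_range_succ]
    linarith

/-! ### Harmonicity, including at the tip -/

/-- **Harmonicity off the row** (`s ≥ 1`): the regularised integrands combine to zero pointwise. [folklore] -/
theorem slitGFun_harmonic (k : ℤ) (r : ℕ) (t : ℝ) :
    slitGFun k (r + 1) t - 1 / 4 * (slitGFun (k - 1) r t + slitGFun (k + 1) r t +
      slitGFun (k - 1) (r + 2) t + slitGFun (k + 1) (r + 2) t) = 0 := by
  have hy : ((chmY t : ℝ) : ℂ) = 1 / 2 * (Real.cos t : ℂ) * (1 + ((chmY t : ℝ) : ℂ) ^ 2) := by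
    have h := congrArg (fun x : ℝ => (x : ℂ)) (chmY_eq_half_cos_mul t)
    push_cast at h
    rw [ofReal_cos]
    exact h
  have hc : cexp (-(((k - 1 : ℤ) : ℂ) * (t : ℂ) * I)) + cexp (-(((k + 1 : ℤ) : ℂ) * (t : ℂ) * I)) =
      2 * (Real.cos t : ℂ) * cexp (-((k : ℂ) * (t : ℂ) * I)) := by
    rw [cexp_sub_one_add_cexp_add_one]; push_cast; ring
  set e0 := cexp (-((k : ℂ) * (t : ℂ) * I)) with he0
  set em := cexp (-(((k - 1 : ℤ) : ℂ) * (t : ℂ) * I)) with hem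
  set ep := cexp (-(((k + 1 : ℤ) : ℂ) * (t : ℂ) * I)) with hep
  set y : ℂ := ((chmY t : ℝ) : ℂ) with hyy
  set B := circBase 1 (2 * t) ^ (-(3 / 2 : ℂ)) with hB
  have key : (e0 * y ^ (r + 1) - 1) - 1 / 4 * ((em * y ^ r - 1) + (ep * y ^ r - 1) + (em * y ^ (r + 2) - 1) +
      (ep * y ^ (r + 2) - 1)) = 0 := by
    have hre : (e0 * y ^ (r + 1) - 1) - 1 / 4 * ((em * y ^ r - 1) + (ep * y ^ r - 1) + (em * y ^ (r + 2) - 1) +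
        (ep * y ^ (r + 2) - 1)) = e0 * y ^ (r + 1) - 1 / 4 * (em + ep) * (y ^ r * (1 + y ^ 2)) := by ring
    rw [hre, hc]
    linear_combination (e0 * y ^ r) * hy
  unfold slitGFun
  rw [← he0, ← hem, ← hep]
  have hfac : (e0 * y ^ (r + 1) - 1) * B - 1 / 4 * ((em * y ^ r - 1) * B + (ep * y ^ r - 1) * B +
      (em * y ^ (r + 2) - 1) * B + (ep * y ^ (r + 2) - 1) * B) =
      ((e0 * y ^ (r + 1) - 1) - 1 / 4 * ((em * y ^ r - 1) + (ep * y ^ r - 1) + (em * y ^ (r + 2) - 1) +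
        (ep * y ^ (r + 2) - 1))) * B := by ring
  rw [hfac, key, zero_mul]

/-- **`G` is harmonic off the row**: `G(k,s) = ¼ ∑ G(k±1, s±1)` for `s ≥ 1`. [cite: ChelkakHonglerIzyurovAnnals2015, Lemma 2.16] -/
theorem slitG_harmonic (k : ℤ) {s : ℕ} (hs : 1 ≤ s) :
    slitG k s = 1 / 4 * (slitG (k - 1) (s - 1) + slitG (k + 1) (s - 1) + slitG (k - 1) (s + 1) + slitG (k + 1) (s + 1)) := by
  obtain ⟨r, rfl⟩ : ∃ r, s = r + 1 := ⟨s - 1, by omega⟩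
  simp only [Nat.add_sub_cancel]
  have hI := intervalIntegrable_slitGFun_re
  have hpt : ∀ t, (slitGFun k (r + 1) t).re = 1 / 4 * ((slitGFun (k - 1) r t).re + (slitGFun (k + 1) r t).re +
      (slitGFun (k - 1) (r + 1 + 1) t).re + (slitGFun (k + 1) (r + 1 + 1) t).re) := by
    intro t
    have h := congrArg Complex.re (slitGFun_harmonic k r t)
    simp only [Complex.sub_re, Complex.zero_re, Complex.mul_re, Complex.add_re] at h
    norm_num at h
    rw [show r + 1 + 1 = r + 2 by ring]
    linarith
  unfold slitG
  rw [intervalIntegral.integral_congr fun t _ => hpt t, intervalIntegral.integral_const_mul,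
    intervalIntegral.integral_add (((hI (k - 1) r).add (hI (k + 1) r)).add (hI (k - 1) (r + 1 + 1)))
      (hI (k + 1) (r + 1 + 1)),
    intervalIntegral.integral_add ((hI (k - 1) r).add (hI (k + 1) r)) (hI (k - 1) (r + 1 + 1)),
    intervalIntegral.integral_add (hI (k - 1) r) (hI (k + 1) r)]
  ring


/-! ### The row: `G` is harmonic on the positive row, tip included -/

/-- `4 sin² t = -e^{-2it}(1 - e^{2it})²`. [folklore] -/
theorem four_sin_sq_eq (t : ℝ) :
    4 * ((Real.sin t : ℝ) : ℂ) ^ 2 = -cexp (-(((2 * t : ℝ) : ℂ) * I)) * circBase 1 (2 * t) ^ 2 := by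
  set em := cexp (-(t : ℂ) * I) with hem
  set ep := cexp ((t : ℂ) * I) with hep
  have h2 : 2 * ((Real.sin t : ℝ) : ℂ) = (em - ep) * I := by
    rw [ofReal_sin]; exact Complex.two_sin _
  have hee : em * ep = 1 := by rw [hem, hep, ← Complex.exp_add, neg_mul, neg_add_cancel, Complex.exp_zero]
  have hB : circBase 1 (2 * t) = 1 - ep ^ 2 := by
    unfold circBase
    rw [ofReal_one, one_mul, hep, ← Complex.exp_nat_mul]; push_cast; ring_nf
  have he2 : cexp (-(((2 * t : ℝ) : ℂ) * I)) = em ^ 2 := by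
    rw [hem, ← Complex.exp_nat_mul]; push_cast; ring_nf
  rw [hB, he2]
  linear_combination (2 * ((Real.sin t : ℝ) : ℂ) + (em - ep) * I) * h2 + (em - ep) ^ 2 * Complex.I_sq +
    (-ep * (2 * em - em * ep ^ 2 - ep)) * hee

/-- **`(1 - e^{2it})^{-3/2} |sin t| = -½ e^{-2it} conj ĝ(t)`** for every `t`. [folklore] -/
theorem circBase_cpow_neg_three_halves_mul_abs_sin (t : ℝ) :
    circBase 1 (2 * t) ^ (-(3 / 2 : ℂ)) * ((|Real.sin t| : ℝ) : ℂ) =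
      -(1 / 2 : ℂ) * cexp (-(((2 * t : ℝ) : ℂ) * I)) * conj (slitGHat t) := by
  by_cases hs : Real.sin t = 0
  · have hB : circBase 1 (2 * t) = 0 := by
      rw [← norm_eq_zero, norm_circBase_one_two_mul, hs, abs_zero, mul_zero]
    have hg : slitGHat t = 0 := by rw [slitGHat, hB, zero_cpow (by norm_num)]
    rw [hB, hg, zero_cpow (by norm_num), zero_mul, map_zero, mul_zero]
  · set B := circBase 1 (2 * t) with hBdef
    have hBn : ‖B‖ = 2 * |Real.sin t| := norm_circBase_one_two_mul t
    have hspos : (0 : ℝ) < |Real.sin t| := abs_pos.2 hs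
    have hBne : B ≠ 0 := by rw [← norm_ne_zero_iff, hBn]; positivity
    have hsne : ((|Real.sin t| : ℝ) : ℂ) ≠ 0 := by exact_mod_cast hspos.ne'
    have h32 : B ^ (-(3 / 2 : ℂ)) = B⁻¹ * slitGHat t := by
      rw [slitGHat, ← hBdef, ← cpow_neg_one, ← cpow_add _ _ hBne]
      norm_num
    have hconj := conj_slitGHat hs
    rw [← hBdef] at hconj
    have hsq := four_sin_sq_eq t
    rw [← hBdef] at hsq
    have hsq' : 4 * ((|Real.sin t| : ℝ) : ℂ) ^ 2 = -cexp (-(((2 * t : ℝ) : ℂ) * I)) * B ^ 2 := by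
      rw [← hsq, ← ofReal_pow, ← ofReal_pow, sq_abs]
    have hkey : ((|Real.sin t| : ℝ) : ℂ) * B⁻¹ = -cexp (-(((2 * t : ℝ) : ℂ) * I)) * B / (4 * ((|Real.sin t| : ℝ) : ℂ)) := by
      field_simp
      linear_combination hsq'
    rw [h32, hconj]
    calc B⁻¹ * slitGHat t * ((|Real.sin t| : ℝ) : ℂ) = slitGHat t * (((|Real.sin t| : ℝ) : ℂ) * B⁻¹) := by ring
      _ = slitGHat t * (-cexp (-(((2 * t : ℝ) : ℂ) * I)) * B / (4 * ((|Real.sin t| : ℝ) : ℂ))) := by rw [hkey]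
      _ = -(1 / 2 : ℂ) * cexp (-(((2 * t : ℝ) : ℂ) * I)) * (slitGHat t * B / (((2 * |Real.sin t|) : ℝ) : ℂ)) := by
          push_cast; field_simp; ring

/-- **The row defect of the regularised integrand**:
`slitGFun k 0 - ½(slitGFun (k-1) 1 + slitGFun (k+1) 1)` has real part `-½ · slitKerFun (-k-2) 0`. [folklore] -/
theorem slitGFun_row_re (k : ℤ) (t : ℝ) :
    (slitGFun k 0 t - 1 / 2 * (slitGFun (k - 1) 1 t + slitGFun (k + 1) 1 t)).re = -(1 / 2) * slitKerFun (-k - 2) 0 t := by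
  have hc : cexp (-(((k - 1 : ℤ) : ℂ) * (t : ℂ) * I)) + cexp (-(((k + 1 : ℤ) : ℂ) * (t : ℂ) * I)) =
      2 * (Real.cos t : ℂ) * cexp (-((k : ℂ) * (t : ℂ) * I)) := by
    rw [cexp_sub_one_add_cexp_add_one]; push_cast; ring
  have hy : (Real.cos t : ℂ) * ((chmY t : ℝ) : ℂ) = 1 - ((|Real.sin t| : ℝ) : ℂ) := by
    have h := cos_mul_chmY t
    exact_mod_cast h
  set e0 := cexp (-((k : ℂ) * (t : ℂ) * I)) with he0
  set em := cexp (-(((k - 1 : ℤ) : ℂ) * (t : ℂ) * I)) with hem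
  set ep := cexp (-(((k + 1 : ℤ) : ℂ) * (t : ℂ) * I)) with hep
  set y : ℂ := ((chmY t : ℝ) : ℂ) with hyy
  set B := circBase 1 (2 * t) ^ (-(3 / 2 : ℂ)) with hB
  have key : slitGFun k 0 t - 1 / 2 * (slitGFun (k - 1) 1 t + slitGFun (k + 1) 1 t) =
      e0 * (B * ((|Real.sin t| : ℝ) : ℂ)) := by
    unfold slitGFun
    rw [← he0, ← hem, ← hep, ← hyy, ← hB]
    simp only [pow_zero, pow_one, mul_one]
    have : (e0 - 1) * B - 1 / 2 * ((em * y - 1) * B + (ep * y - 1) * B) = (e0 - 1 / 2 * (em + ep) * y) * B := by ring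
    rw [this, hc]
    have : (e0 - 1 / 2 * (2 * (Real.cos t : ℂ) * e0) * y) = e0 * (1 - (Real.cos t : ℂ) * y) := by ring
    rw [this, hy]; ring
  rw [key, circBase_cpow_neg_three_halves_mul_abs_sin, slitKerFun, pow_zero, mul_one,
    show (-k - 2 : ℤ) = -(k + 2) by ring, slitCFun_neg_int_re]
  have : e0 * (-(1 / 2 : ℂ) * cexp (-(((2 * t : ℝ) : ℂ) * I)) * conj (slitGHat t)) =
      (((-(1 / 2) : ℝ)) : ℂ) * (cexp (-(((k + 2 : ℤ) : ℂ) * (t : ℂ) * I)) * conj (slitGHat t)) := by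
    rw [he0, show cexp (-(((k + 2 : ℤ) : ℂ) * (t : ℂ) * I)) = cexp (-((k : ℂ) * (t : ℂ) * I)) * cexp (-(((2 * t : ℝ) : ℂ) * I)) by
      rw [← Complex.exp_add]; push_cast; ring_nf]
    push_cast; ring
  rw [this, re_ofReal_mul]

/-- **The row identity for `G`**: `G(k,0) - ½[G(k-1,1) + G(k+1,1)] = -½ K(-k-2, 0)`; in particular
`G` is harmonic at every `(2m, 0)` with `m ≥ 0` — **including the tip** (CHI: "harmonic everywhere
inside `Ξ_+`, including the point `a + 3δ/2`"). [cite: ChelkakHonglerIzyurovAnnals2015, §3.2.3 (proof of Lemma 2.16)] -/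
theorem slitG_row (k : ℤ) :
    slitG k 0 - 1 / 2 * (slitG (k - 1) 1 + slitG (k + 1) 1) = -(1 / 2) * slitKernel (-k - 2) 0 := by
  have hI := intervalIntegrable_slitGFun_re
  have hK := intervalIntegrable_slitKerFun (-k - 2) 0
  have hcomb : slitG k 0 - 1 / 2 * (slitG (k - 1) 1 + slitG (k + 1) 1) =
      1 / π * ∫ t in (-(π / 2))..(π / 2), ((slitGFun k 0 t).re - 1 / 2 * ((slitGFun (k - 1) 1 t).re + (slitGFun (k + 1) 1 t).re)) := by
    simp only [slitG]
    rw [intervalIntegral.integral_sub (hI _ _) (((hI _ _).add (hI _ _)).const_mul _),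
      intervalIntegral.integral_const_mul, intervalIntegral.integral_add (hI _ _) (hI _ _)]
    ring
  have hpt : ∀ t, (slitGFun k 0 t).re - 1 / 2 * ((slitGFun (k - 1) 1 t).re + (slitGFun (k + 1) 1 t).re) =
      -(1 / 2) * slitKerFun (-k - 2) 0 t := by
    intro t
    have h := slitGFun_row_re k t
    simp only [Complex.sub_re, Complex.mul_re, Complex.add_re] at h
    norm_num at h
    linarith
  rw [hcomb, intervalIntegral.integral_congr fun t _ => hpt t, intervalIntegral.integral_const_mul, slitKernel]
  ring

/-- **`G` is harmonic on the positive row, tip included**: `G(2m,0) = ½[G(2m-1,1) + G(2m+1,1)]`, `m ≥ 0`.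
[cite: ChelkakHonglerIzyurovAnnals2015, Lemma 2.16 and §3.2.3] -/
theorem slitG_row_of_nonneg {m : ℤ} (hm : 0 ≤ m) :
    slitG (2 * m) 0 = 1 / 2 * (slitG (2 * m - 1) 1 + slitG (2 * m + 1) 1) := by
  have h := slitG_row (2 * m)
  rw [show (-(2 * m) - 2 : ℤ) = 2 * (-m - 1) by ring, slitKernel_two_mul_zero_of_neg (by omega), mul_zero] at h
  linarith

/-! ### `G` as a lattice function on `ℤ²` -/

/-- **The discrete primitive on `ℤ²`**: `slitGM (a, b) = G(a + b, |a - b|)` — CHI's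
`G_{[ℂ_δ,a]}` (Lemma 2.16), the discrete `Re √(z - a)`. [cite: ChelkakHonglerIzyurovAnnals2015, Lemma 2.16] -/
def slitGM (v : Site 2) : ℝ := slitG (v 0 + v 1) (v 0 - v 1).natAbs

/-- Unfolding `slitGM`. [folklore] -/
theorem slitGM_apply (v : Site 2) : slitGM v = slitG (v 0 + v 1) (v 0 - v 1).natAbs := rfl

/-- **Value at the tip**: `slitGM 0 = 1` (CHI's `G(a + 3δ/2) = δ`). [cite: ChelkakHonglerIzyurovAnnals2015, Lemma 2.16] -/
theorem slitGM_zero : slitGM 0 = 1 := by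
  simp only [slitGM_apply, Pi.zero_apply, add_zero, sub_zero, Int.natAbs_zero]
  exact slitG_zero_zero

/-- **`slitGM` vanishes on the slit**: `slitGM (-m, -m) = 0`, `m ≥ 1`. [cite: ChelkakHonglerIzyurovAnnals2015, Lemma 2.16] -/
theorem slitGM_diag_neg (m : ℕ) (hm : 1 ≤ m) : slitGM ![-(m : ℤ), -(m : ℤ)] = 0 := by
  simp only [slitGM_apply, Matrix.cons_val_zero, Matrix.cons_val_one, sub_self, Int.natAbs_zero]
  rw [show (-(m : ℤ) + -(m : ℤ)) = -(2 * (m : ℤ)) by ring]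
  exact slitG_slit m hm

/-- **The positive diagonal**: `slitGM (m, m) = ∑_{j ≤ m} binom(2j,j)/4^j`. [cite: ChelkakHonglerIzyurovAnnals2015, Lemma 2.16] -/
theorem slitGM_diag (m : ℕ) : slitGM ![(m : ℤ), m] = ∑ j ∈ Finset.range (m + 1), (j.centralBinom : ℝ) / 4 ^ j := by
  simp only [slitGM_apply, Matrix.cons_val_zero, Matrix.cons_val_one, sub_self, Int.natAbs_zero]
  rw [← two_mul]
  exact slitG_two_mul m

/-- The Laplacian of `slitGM` in the coordinates `k = a + b`, `s = a - b`. [folklore] -/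
theorem latticeLaplacian_slitGM (v : Site 2) :
    latticeLaplacian slitGM v =
      slitG (v 0 + v 1 + 1) (v 0 - v 1 + 1).natAbs + slitG (v 0 + v 1 + 1) (v 0 - v 1 - 1).natAbs +
      slitG (v 0 + v 1 - 1) (v 0 - v 1 - 1).natAbs + slitG (v 0 + v 1 - 1) (v 0 - v 1 + 1).natAbs -
      4 * slitG (v 0 + v 1) (v 0 - v 1).natAbs := by
  rw [latticeLaplacian_eq, Fin.sum_univ_four]
  have c0 : (v + cornerUnit 0) 0 = v 0 + 1 ∧ (v + cornerUnit 0) 1 = v 1 := by simp [cornerUnit]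
  have c1 : (v + cornerUnit 1) 0 = v 0 ∧ (v + cornerUnit 1) 1 = v 1 + 1 := by simp [cornerUnit]
  have c2 : (v + cornerUnit 2) 0 = v 0 - 1 ∧ (v + cornerUnit 2) 1 = v 1 := by simp [cornerUnit, sub_eq_add_neg]
  have c3 : (v + cornerUnit 3) 0 = v 0 ∧ (v + cornerUnit 3) 1 = v 1 - 1 := by simp [cornerUnit, sub_eq_add_neg]
  simp only [slitGM_apply, c0.1, c0.2, c1.1, c1.2, c2.1, c2.2, c3.1, c3.2]
  have e1 : v 0 + 1 + v 1 = v 0 + v 1 + 1 := by ring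
  have e2 : v 0 + 1 - v 1 = v 0 - v 1 + 1 := by ring
  have e3 : v 0 + (v 1 + 1) = v 0 + v 1 + 1 := by ring
  have e4 : v 0 - (v 1 + 1) = v 0 - v 1 - 1 := by ring
  have e5 : v 0 - 1 + v 1 = v 0 + v 1 - 1 := by ring
  have e6 : v 0 - 1 - v 1 = v 0 - v 1 - 1 := by ring
  have e7 : v 0 + (v 1 - 1) = v 0 + v 1 - 1 := by ring
  have e8 : v 0 - (v 1 - 1) = v 0 - v 1 + 1 := by ring
  rw [e1, e2, e3, e4, e5, e6, e7, e8]

/-- **`slitGM` is lattice-harmonic off the diagonal.** [cite: ChelkakHonglerIzyurovAnnals2015, Lemma 2.16] -/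
theorem latticeLaplacian_slitGM_of_ne {v : Site 2} (hv : v 0 ≠ v 1) : latticeLaplacian slitGM v = 0 := by
  rw [latticeLaplacian_slitGM]
  set k := v 0 + v 1
  set n := (v 0 - v 1).natAbs with hn
  have hn1 : 1 ≤ n := by omega
  have h := slitG_harmonic k hn1
  rcases lt_or_gt_of_ne hv with hlt | hgt
  · have h1 : (v 0 - v 1 + 1).natAbs = n - 1 := by omega
    have h2 : (v 0 - v 1 - 1).natAbs = n + 1 := by omega
    rw [h1, h2]; linarith
  · have h1 : (v 0 - v 1 + 1).natAbs = n + 1 := by omega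
    have h2 : (v 0 - v 1 - 1).natAbs = n - 1 := by omega
    rw [h1, h2]; linarith

/-- On the diagonal the Laplacian of `slitGM` is `2 K(-2j-2, 0)`. [folklore] -/
theorem latticeLaplacian_slitGM_diag (j : ℤ) : latticeLaplacian slitGM ![j, j] = 2 * slitKernel (-(2 * j) - 2) 0 := by
  rw [latticeLaplacian_slitGM]
  simp only [Matrix.cons_val_zero, Matrix.cons_val_one, sub_self, zero_add, zero_sub, Int.natAbs_zero]
  rw [show (1 : ℤ).natAbs = 1 from rfl, show (-1 : ℤ).natAbs = 1 from rfl, ← two_mul j]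
  have h := slitG_row (2 * j)
  linarith

/-- **`slitGM` is lattice-harmonic on the nonnegative diagonal, the tip `0` included.**
[cite: ChelkakHonglerIzyurovAnnals2015, Lemma 2.16 and §3.2.3] -/
theorem latticeLaplacian_slitGM_diag_of_nonneg {j : ℤ} (hj : 0 ≤ j) : latticeLaplacian slitGM ![j, j] = 0 := by
  rw [latticeLaplacian_slitGM_diag, show (-(2 * j) - 2 : ℤ) = 2 * (-j - 1) by ring,
    slitKernel_two_mul_zero_of_neg (by omega), mul_zero]

/-- **`slitGM` is harmonic at the tip.** [cite: ChelkakHonglerIzyurovAnnals2015, Lemma 2.16] -/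
theorem latticeLaplacian_slitGM_zero : latticeLaplacian slitGM 0 = 0 := by
  have h := latticeLaplacian_slitGM_diag_of_nonneg (le_refl (0 : ℤ))
  have h0 : (![(0 : ℤ), 0] : Site 2) = 0 := by ext i; fin_cases i <;> rfl
  rwa [h0] at h

/-- **The flux into the slit**: at `(-m, -m)`, `m ≥ 1`, `Δ slitGM = 2 binom(2m-2, m-1)/4^{m-1} > 0`. [folklore] -/
theorem latticeLaplacian_slitGM_diag_of_neg (m : ℕ) (hm : 1 ≤ m) :
    latticeLaplacian slitGM ![-(m : ℤ), -(m : ℤ)] = 2 * (((m - 1).centralBinom : ℝ) / 4 ^ (m - 1)) := by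
  obtain ⟨n, rfl⟩ : ∃ n, m = n + 1 := ⟨m - 1, by omega⟩
  rw [latticeLaplacian_slitGM_diag, show (-(2 * -(((n + 1 : ℕ) : ℤ))) - 2 : ℤ) = 2 * (n : ℤ) by push_cast; ring,
    slitKernel_two_mul_natCast_zero, Nat.add_sub_cancel]

end Literature.Probability.LatticeModels
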